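import Summits.MatrixMultiplication.OmegaCensus.STPP222IcosetClassNoneK6
import Summits.MatrixMultiplication.OmegaCensus.STPP222IcosetClassNoneK6Z11A3
import Summits.MatrixMultiplication.OmegaCensus.STPP222IcosetClassNoneK6Z11B2
import Summits.MatrixMultiplication.OmegaCensus.STPP222IcosetClassNoneK6Z11C2
import Summits.MatrixMultiplication.OmegaCensus.STPP222IcosetClassNoneK6Z11D
import Summits.MatrixMultiplication.OmegaCensus.STPP222IcosetClassNoneK6Z11E
import Mathlib.Tactic.IntervalCases

/-!
# ω-census, icoset class negatives, KERNEL: no involution-coset `(2,2,2)⁶` family in `𝔽₂³ × ℤ₁₁` (order 88)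

HONEST FRAMING (pub-omega census; verbatim): lottery ticket; floor = certified bounds/negative ranges.
Census STRUCTURE bookkeeping (question Q7; a CLASS-INTERNAL negative — nothing about unrestricted `(2,2,2)⁶` families, nothing about `ω`).
Order 88 = `16·6 − 8` is the cell of prereg P-016.1 (the fitted onset law `n_k = 16k − 8` predicts a `(2,2,2)⁶` host of order 88); the engine-grade
class census (ENG2 g27, `ICOSET-NOTE.md`: ℤ₂³×ℤ₁₁ K = 6 NONE, 151 112 h-nodes, 0 slot-consistent) said the involution-coset class cannot supply it.
Here that verdict is KERNEL: the chunked evaluations `checkFrom (cyc 11) 6 x y = true` of parts A1–A3, B1–B2, C1–C2, D, E are assembled into `IcosetH.check (cyc 11) 6 = true`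
(`check_of_forall_checkFrom`: the root of the search splits over the level-1 choices) and pushed through `Icoset.not_exists_of_check`.
References: H. Cohn, R. Kleinberg, B. Szegedy, C. Umans, FOCS 2005 (arXiv:math/0511460), Def. 5.1.  Seat pub-omega-kernel-l4 (gen 19), 2026-08-27.
-/

namespace Summit.MatrixMultiplication.OmegaCensus

open Literature.Computability.AlgebraicComplexity

namespace IcosetH

/-- **Chunked evaluation.**  The root of the search splits over the level-1 choices `(b₁, c₁)`: `check` follows from all `checkFrom`.
[folklore] -/
theorem check_of_forall_checkFrom {A : CArith} {K : ℕ} (hK : 2 ≤ K)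
    (h : ∀ x, x < A.nEl → ∀ y, y < A.nEl → checkFrom A K x y = true) : check A K = true := by
  obtain ⟨r, hr⟩ : ∃ r, K - 1 = r + 1 := ⟨K - 2, by omega⟩
  have hr' : K - 2 = r := by omega
  rw [check, hr, dfs_succ]
  refine allN_of_forall fun x hx => ?_
  rw [forceN_eq]
  cases hbx : Nat.ble x (getI [0] (1 - 1))
  · rw [Bool.false_or]
    refine allN_of_forall fun y hy => ?_
    have hc := h x hx y hy
    rw [checkFrom] at hc
    have hbx' : Nat.ble x 0 = false := hbx
    rw [hbx', Bool.false_or, applyMerges_eq, hr'] at hc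
    rw [applyMerges_eq, forceL_eq, forceL_eq]
    exact hc
  · rfl

/-- **Kernel evaluation, assembled:** the H-stage search for `ℤ₁₁`, `K = 6` (151 112 nodes over parts A–C). -/
theorem check_cyc11_six : check (cyc 11) 6 = true :=
  check_of_forall_checkFrom (by norm_num) fun x hx y hy => by
    change x < 11 at hx; change y < 11 at hy
    interval_cases x
    exacts [checkFrom_cyc11_0 y hy, checkFrom_cyc11_1 y hy, checkFrom_cyc11_2 y hy, checkFrom_cyc11_3 y hy, checkFrom_cyc11_4 y hy,
      checkFrom_cyc11_5 y hy, checkFrom_cyc11_6 y hy, checkFrom_cyc11_7 y hy, checkFrom_cyc11_8 y hy, checkFrom_cyc11_9 y hy,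
      checkFrom_cyc11_10 y hy]

end IcosetH

/-- **`𝔽₂³ × ℤ₁₁` (order 88 = 16·6 − 8, the P-016.1 cell) has no involution-coset `(2,2,2)⁶` STPP family** — KERNEL (class-internal negative).
[cite: CohnKleinbergSzegedyUmans2005, Def. 5.1] -/
theorem no_icoset_pow6_F2cube_zmod11 :
    ¬ ∃ A B C : Fin 6 → Finset ((ZMod 2 × ZMod 2 × ZMod 2) × ZMod 11), Icoset.IsIcosetFamily A B C ∧ IsSTPP A B C :=
  Icoset.not_exists_of_check IcosetH.finrank_F2_cube (IcosetH.encZMod 11) (by norm_num) IcosetH.check_cyc11_six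

end Summit.MatrixMultiplication.OmegaCensus
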